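import Literature.NumberTheory.EllipticCurves.HasseWeilGoodReductionFrobeniusProofs
import Literature.NumberTheory.GaloisRepresentations.FrobeniusGeneration
import HarnessLib

/-!
# `Γ_{K_v}` is generated by a Frobenius and the inertia group, modulo open subgroups

`Proofs` file (theorems only, no definitions, no named facts) in topic
`NumberTheory/EllipticCurves`; first bottom-up step of the discharge of the named fact
`Literature.NumberTheory.EllipticCurves.Milne2006_unramifiedClass_eq_zero` (`PeriodIndexSupport`;
Milne, *Arithmetic Duality Theorems*, Prop. I.3.8: `H¹(G/I, A(K^un)) = 0` for good reduction),
whose proof runs over the finite unramified layers of `K̄_v / K_v` and needs the structure of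
`Γ_{K_v} / I_v ≅ Gal(k̄_v / k_v) ≅ Ẑ` in the following finite form.

Let `K` be a number field, `v` a finite place, `K_v` the completion, `Γ = Γ_{K_v} = Gal(K̄_v/K_v)`
acting on the local absolute integers `\bar 𝓞_v ⊆ K̄_v` (`SelmerInertia`), `𝔐` a prime of
`\bar 𝓞_v` above `𝓂_v` (there is exactly one), `I = I_𝔐 ≤ Γ` its inertia group and `F ∈ Γ` an
arithmetic Frobenius at `𝔐` (`F b ≡ b^{q_v} (mod 𝔐)`, Mathlib `IsArithFrobAt`; existence is the
tree's `exists_isArithFrobAt_localAbsIntegers`).  We prove: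

* `smul_eq_of_mem_localPrimesAbove`: every `σ ∈ Γ` fixes `𝔐` (the decomposition group is all of
  `Γ`: `σ • 𝔐` is again a prime above `𝓂_v`, and there is only one,
  `eq_of_liesOver_maximalIdeal_adicCompletion` of `ClosureValuation`);
* `exists_forall_smul_sub_pow_mem_local`: every `σ ∈ Γ` acts on finitely many residues as a
  power of the `q_v`-Frobenius (finite-field Galois theory, the tree's
  `exists_forall_algEquiv_apply_eq_pow` of `GaloisRepresentations/FrobeniusGeneration`);
* **`exists_eq_frobenius_pow_mul_inertia_mul`**: for every open subgroup `U ≤ Γ` and every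
  `σ ∈ Γ` there are `n ∈ ℕ`, `τ ∈ I`, `u ∈ U` with `σ = Fⁿ · τ · u` — i.e. in every finite
  (discrete) quotient of `Γ`, the images of `F` and `I` generate.  This is the local counterpart
  of the tree's `exists_eq_frobenius_pow_mul_of_mem_decompositionSubgroup` (the same statement
  for the decomposition group of a prime of `\bar ℤ_K` in `Γ_K`), with the same proof:
  compactness of `Γ` (the closed sets `{σ : σ x ≡ x (mod 𝔐), x ∈ S}`, `S` finite, are directed
  with intersection `I ⊆ I · U`) and Frobenius powers on the finite field generated by the
  residues of `S`.

Classically: `Γ/I ≅ G(λ|κ)` is topologically generated by the Frobenius (Neukirch, *ANT*, II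
(9.9)–(9.11); Serre, *Local Fields*, I §8 and IV; Milne, *ADT*, §I.2 opening: `G = Gal(K^s/K)`,
`I = Gal(K^s/K^un)`, `G/I ≅ Ẑ`).

## References

* [NeukirchANT1999] J. Neukirch, *Algebraic Number Theory* (1999), Ch. I §9 (9.4); Ch. II §9
  (9.9)–(9.11).
* [SerreLocalFields1979] J.-P. Serre, *Local Fields* (1979), Ch. I §7–§8.
* [MilneADT2006] J. S. Milne, *Arithmetic Duality Theorems*, 2nd ed. (2006), §I.2 (notation
  `G`, `I`, `K^un`), Prop. I.3.8.

## Design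

No definitions; `noncomputable section`; `open scoped Classical Pointwise`; one universe `u`
(`K : Type u`, as in `Sha`/`SelmerInertia`/`HasseWeilGoodReductionFrobeniusProofs`).
-/

noncomputable section

open scoped Classical Pointwise
open NumberField IsDedekindDomain

universe u

namespace IsDedekindDomain.HeightOneSpectrum

open Literature.NumberTheory.EllipticCurves Literature.NumberTheory.GaloisRepresentations Field

variable {K : Type u} [Field K] [NumberField K] (v : HeightOneSpectrum (𝓞 K))

/-- **The decomposition group of `𝔐` is all of `Γ_{K_v}`**: every `σ ∈ Gal(K̄_v/K_v)` fixes the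
prime `𝔐` of `\bar 𝓞_v` above `𝓂_v` (`σ • 𝔐` is a prime above `𝓂_v`, and `𝔐` is the only one:
`K_v` is henselian; Neukirch, *ANT*, Ch. II (6.2), (8.1)). [folklore] -/
theorem smul_eq_of_mem_localPrimesAbove {𝔐 : Ideal (localAbsIntegers v)}
    (h𝔐 : 𝔐 ∈ v.localPrimesAbove) (σ : absoluteGaloisGroup (v.adicCompletion K)) :
    σ • 𝔐 = 𝔐 := by
  haveI := h𝔐.1
  haveI := h𝔐.2
  haveI : (σ • 𝔐).LiesOver (IsLocalRing.maximalIdeal (v.adicCompletionIntegers K)) :=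
    ⟨by rw [Ideal.under_smul]; exact h𝔐.2.over⟩
  exact eq_of_liesOver_maximalIdeal_adicCompletion v (σ • 𝔐) 𝔐

/-- Every `σ ∈ Γ_{K_v}` lies in the stabiliser (decomposition group) of `𝔐`. [folklore] -/
theorem mem_stabilizer_of_mem_localPrimesAbove {𝔐 : Ideal (localAbsIntegers v)}
    (h𝔐 : 𝔐 ∈ v.localPrimesAbove) (σ : absoluteGaloisGroup (v.adicCompletion K)) :
    σ ∈ MulAction.stabilizer (absoluteGaloisGroup (v.adicCompletion K)) 𝔐 :=
  smul_eq_of_mem_localPrimesAbove v h𝔐 σ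

/-- The inertia group `I_𝔐 ≤ Γ_{K_v}` is normal (its normaliser contains the decomposition group,
which is everything). Neukirch, *ANT*, Ch. I §9 (9.6)/(9.4). [folklore] -/
theorem inertia_normal_of_mem_localPrimesAbove {𝔐 : Ideal (localAbsIntegers v)}
    (h𝔐 : 𝔐 ∈ v.localPrimesAbove) :
    (𝔐.inertia (absoluteGaloisGroup (v.adicCompletion K))).Normal := by
  refine ⟨fun τ hτ σ x ↦ ?_⟩
  -- `(σ τ σ⁻¹) x - x = σ (τ (σ⁻¹ x) - σ⁻¹ x)`
  have h1 : (σ * τ * σ⁻¹) • x - x = σ • (τ • (σ⁻¹ • x) - σ⁻¹ • x) := by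
    rw [smul_sub, ← mul_smul, ← mul_smul, smul_inv_smul, mul_assoc]
  rw [h1]
  have h2 := Ideal.smul_mem_pointwise_smul σ _ 𝔐 (hτ (σ⁻¹ • x))
  rwa [smul_eq_of_mem_localPrimesAbove v h𝔐 σ] at h2

/-- Powers of a local arithmetic Frobenius: `Fⁿ • x ≡ x^{q_vⁿ} (mod 𝔐)`, `q_v = #k_v`.
Neukirch, *ANT*, Ch. I §9 (9.4)–(9.6). [folklore] -/
theorem pow_smul_sub_pow_mem_of_isArithFrobAt_local {𝔐 : Ideal (localAbsIntegers v)}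
    (h𝔐 : 𝔐 ∈ v.localPrimesAbove) {F : absoluteGaloisGroup (v.adicCompletion K)}
    (hF : IsArithFrobAt (v.adicCompletionIntegers K) F 𝔐) (n : ℕ) (x : localAbsIntegers v) :
    F ^ n • x - x ^ (Nat.card (IsLocalRing.ResidueField (v.adicCompletionIntegers K)) ^ n) ∈ 𝔐 := by
  set q := Nat.card (IsLocalRing.ResidueField (v.adicCompletionIntegers K)) with hq
  have hF' : ∀ y : localAbsIntegers v, F • y - y ^ q ∈ 𝔐 := fun y ↦ by
    have := hF y
    rwa [natCard_quotient_under_eq_of_mem_localPrimesAbove v h𝔐] at this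
  induction n generalizing x with
  | zero => simp
  | succ k ih =>
    rw [pow_succ', mul_smul, pow_succ, pow_mul]
    have h1 := hF' (F ^ k • x)
    have h2 : (F ^ k • x) ^ q - (x ^ q ^ k) ^ q ∈ 𝔐 := by
      rw [← Ideal.Quotient.eq_zero_iff_mem, map_sub, map_pow, map_pow, sub_eq_zero]
      congr 1
      rw [← sub_eq_zero, ← map_sub, Ideal.Quotient.eq_zero_iff_mem]
      exact ih x
    have := add_mem h1 h2
    rwa [sub_add_sub_cancel] at this

/-- **An element of `Γ_{K_v}` acts on finitely many residues as a power of Frobenius**: for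
`σ ∈ Γ_{K_v}` and a finite `S ⊆ \bar 𝓞_v` there is `n` with `σ • x ≡ x^{q_vⁿ} (mod 𝔐)` for all
`x ∈ S` (the automorphism of `(\bar 𝓞_v/𝔐) / k_v` induced by `σ`, Mathlib
`Ideal.Quotient.stabilizerHom`, is a power of the `q_v`-Frobenius on the finite subfield
generated by the residues of `S`). Neukirch, *ANT*, Ch. I §9 Prop. (9.4); Serre, *Local Fields*,
Ch. I §7–§8. [folklore] -/
theorem exists_forall_smul_sub_pow_mem_local {𝔐 : Ideal (localAbsIntegers v)}
    (h𝔐 : 𝔐 ∈ v.localPrimesAbove) (σ : absoluteGaloisGroup (v.adicCompletion K))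
    (S : Finset (localAbsIntegers v)) :
    ∃ n : ℕ, ∀ x ∈ S,
      σ • x - x ^ (Nat.card (IsLocalRing.ResidueField (v.adicCompletionIntegers K)) ^ n) ∈ 𝔐 := by
  classical
  haveI : 𝔐.IsPrime := h𝔐.1
  haveI := h𝔐.2
  set O := v.adicCompletionIntegers K with hO
  set p : Ideal O := IsLocalRing.maximalIdeal O with hp
  haveI : p.IsMaximal := IsLocalRing.maximalIdeal.isMaximal O
  haveI : 𝔐.IsMaximal := Ideal.isMaximal_of_isIntegral_of_isMaximal_comap (R := O) 𝔐
    (by rw [← Ideal.under_def, under_eq_maximalIdeal_of_mem_localPrimesAbove v h𝔐]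
        exact IsLocalRing.maximalIdeal.isMaximal _)
  haveI : Finite (O ⧸ p) := finite_residueField_adicCompletionIntegers K v
  letI : Fintype (O ⧸ p) := Fintype.ofFinite _
  letI : Field (O ⧸ p) := Ideal.Quotient.field p
  letI : Field (localAbsIntegers v ⧸ 𝔐) := Ideal.Quotient.field 𝔐
  haveI : Algebra.IsAlgebraic (O ⧸ p) (localAbsIntegers v ⧸ 𝔐) :=
    Algebra.IsIntegral.isAlgebraic
  have hq : Fintype.card (O ⧸ p) = Nat.card (IsLocalRing.ResidueField O) := by
    rw [Fintype.card_eq_nat_card]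
    rfl
  let σ' : (localAbsIntegers v ⧸ 𝔐) ≃ₐ[O ⧸ p] (localAbsIntegers v ⧸ 𝔐) :=
    Ideal.Quotient.stabilizerHom 𝔐 p (absoluteGaloisGroup (v.adicCompletion K))
      ⟨σ, mem_stabilizer_of_mem_localPrimesAbove v h𝔐 σ⟩
  have hσ' : ∀ x, σ' (Ideal.Quotient.mk 𝔐 x) = Ideal.Quotient.mk 𝔐 (σ • x) := fun x ↦ rfl
  obtain ⟨n, hn⟩ := exists_forall_algEquiv_apply_eq_pow σ' (S.image (Ideal.Quotient.mk 𝔐))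
  refine ⟨n, fun x hx ↦ ?_⟩
  have h1 := hn _ (Finset.mem_image_of_mem _ hx)
  rw [hσ', hq, ← map_pow] at h1
  rw [← Ideal.Quotient.eq_zero_iff_mem, map_sub, sub_eq_zero]
  exact h1

/-- The set `{g | g • x - x ∈ 𝔐}` is closed in `Γ_{K_v}` (the action on the discrete `\bar 𝓞_v`
is continuous, `absIntegers.continuousSMul`). [folklore] -/
theorem isClosed_setOf_smul_sub_mem_local (𝔐 : Ideal (localAbsIntegers v))
    (x : localAbsIntegers v) :
    IsClosed {g : absoluteGaloisGroup (v.adicCompletion K) | g • x - x ∈ 𝔐} := by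
  letI : TopologicalSpace (localAbsIntegers v) := ⊥
  haveI : DiscreteTopology (localAbsIntegers v) := ⟨rfl⟩
  haveI := absIntegers.continuousSMul (v.adicCompletionIntegers K) (K := v.adicCompletion K)
  have hc : Continuous fun g : absoluteGaloisGroup (v.adicCompletion K) ↦ g • x :=
    continuous_id.smul continuous_const
  exact (isClosed_discrete {y : localAbsIntegers v | y - x ∈ 𝔐}).preimage hc

/-- **`Γ_{K_v} = ⟨F⟩ · I_𝔐 · U` for every open subgroup `U`.**  Let `𝔐` be a prime of the local
absolute integers `\bar 𝓞_v` above `𝓂_v`, `F ∈ Γ_{K_v}` an arithmetic Frobenius at `𝔐` and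
`U ≤ Γ_{K_v}` an open subgroup.  Every `σ ∈ Γ_{K_v}` can be written `σ = Fⁿ · τ · u` with
`n ∈ ℕ`, `τ ∈ I_𝔐` and `u ∈ U`; equivalently, in every finite discrete quotient of `Γ_{K_v}` the
images of `F` and of the inertia group generate (the quotient `Γ_{K_v}/I_𝔐 ≅ Gal(k̄_v/k_v)` is
topologically generated by the Frobenius).  Proof by compactness of `Γ_{K_v}` and finite-field
Galois theory, exactly as the tree's global statement
`exists_eq_frobenius_pow_mul_of_mem_decompositionSubgroup` (`GaloisRepresentations/FrobeniusGeneration`).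
Neukirch, *ANT*, Ch. II §9 (9.9)–(9.11) (`1 → I → G → G(λ|κ) → 1`, the inertia field is the
maximal unramified extension); Serre, *Local Fields*, Ch. I §8; Milne, *ADT*, §I.2 (`G/I ≅ Ẑ`).
[cite: NeukirchANT1999, Ch. II §9 Prop. (9.9)–(9.11)] -/
theorem exists_eq_frobenius_pow_mul_inertia_mul {𝔐 : Ideal (localAbsIntegers v)}
    (h𝔐 : 𝔐 ∈ v.localPrimesAbove) {F : absoluteGaloisGroup (v.adicCompletion K)}
    (hF : IsArithFrobAt (v.adicCompletionIntegers K) F 𝔐)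
    {U : Subgroup (absoluteGaloisGroup (v.adicCompletion K))}
    (hU : IsOpen (U : Set (absoluteGaloisGroup (v.adicCompletion K))))
    (σ : absoluteGaloisGroup (v.adicCompletion K)) :
    ∃ (n : ℕ) (τ u : absoluteGaloisGroup (v.adicCompletion K)),
      τ ∈ 𝔐.inertia (absoluteGaloisGroup (v.adicCompletion K)) ∧ u ∈ U ∧ σ = F ^ n * τ * u := by
  classical
  haveI : 𝔐.IsPrime := h𝔐.1
  haveI : CharZero (v.adicCompletion K) :=
    charZero_of_injective_algebraMap (algebraMap K (v.adicCompletion K)).injective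
  let I : Subgroup (absoluteGaloisGroup (v.adicCompletion K)) :=
    𝔐.inertia (absoluteGaloisGroup (v.adicCompletion K))
  -- the open set `W = I · U`
  set W : Set (absoluteGaloisGroup (v.adicCompletion K)) :=
    ⋃ i ∈ I, i • (U : Set (absoluteGaloisGroup (v.adicCompletion K))) with hW
  have hWopen : IsOpen W := isOpen_biUnion fun i _ ↦ hU.smul i
  have hWmem : ∀ g, g ∈ W ↔ ∃ i ∈ I, ∃ u ∈ U, g = i * u := by
    intro g
    simp only [hW, Set.mem_iUnion, Set.mem_smul_set, smul_eq_mul, exists_prop]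
    constructor
    · rintro ⟨i, hi, u, hu, rfl⟩; exact ⟨i, hi, u, hu, rfl⟩
    · rintro ⟨i, hi, u, hu, rfl⟩; exact ⟨i, hi, u, hu, rfl⟩
  have hIW : ∀ i ∈ I, i ∈ W := fun i hi ↦ (hWmem i).mpr ⟨i, hi, 1, U.one_mem, (mul_one i).symm⟩
  -- the closed sets `K_S`
  set KS : Finset (localAbsIntegers v) → Set (absoluteGaloisGroup (v.adicCompletion K)) :=
    fun S ↦ ⋂ x ∈ S, {g | g • x - x ∈ 𝔐} with hKS
  have hKSclosed : ∀ S, IsClosed (KS S) := fun S ↦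
    isClosed_biInter fun x _ ↦ isClosed_setOf_smul_sub_mem_local v 𝔐 x
  have hmemKS : ∀ S g, g ∈ KS S ↔ ∀ x ∈ S, g • x - x ∈ 𝔐 := by
    intro S g
    simp only [hKS, Set.mem_iInter, Set.mem_setOf_eq]
  -- compactness: some `K_S ⊆ W`
  have hcpt : IsCompact Wᶜ := hWopen.isClosed_compl.isCompact
  have hempty : Wᶜ ∩ ⋂ S, KS S = ∅ := by
    rw [Set.eq_empty_iff_forall_notMem]
    rintro g ⟨hgW, hall⟩
    rw [Set.mem_iInter] at hall
    exact hgW (hIW g fun x ↦ (hmemKS {x} g).mp (hall {x}) x (Finset.mem_singleton_self x))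
  have hdir : Directed (· ⊇ ·) KS := by
    intro S₁ S₂
    refine ⟨S₁ ∪ S₂, fun g hg ↦ ?_, fun g hg ↦ ?_⟩
    · rw [hmemKS] at hg ⊢
      exact fun x hx ↦ hg x (Finset.mem_union_left _ hx)
    · rw [hmemKS] at hg ⊢
      exact fun x hx ↦ hg x (Finset.mem_union_right _ hx)
  obtain ⟨S, hS⟩ := hcpt.elim_directed_family_closed KS hKSclosed hempty hdir
  have hKSW : KS S ⊆ W := by
    intro g hg
    by_contra hgW
    have : g ∈ Wᶜ ∩ KS S := ⟨hgW, hg⟩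
    rw [hS] at this
    exact this
  -- Frobenius powers on the residues of `S`
  obtain ⟨n, hn⟩ := exists_forall_smul_sub_pow_mem_local v h𝔐 σ S
  set g := (F ^ n)⁻¹ * σ with hg
  have hgKS : g ∈ KS S := by
    refine (hmemKS S g).mpr fun x hx ↦ ?_
    -- `g • x - x = F⁻ⁿ • (σ • x - Fⁿ • x)` with `σ • x ≡ x^{qⁿ} ≡ Fⁿ • x`
    have h1 : σ • x - F ^ n • x ∈ 𝔐 := by
      have := sub_mem (hn x hx) (pow_smul_sub_pow_mem_of_isArithFrobAt_local v h𝔐 hF n x)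
      rwa [sub_sub_sub_cancel_right] at this
    have h2 : g • x - x = (F ^ n)⁻¹ • (σ • x - F ^ n • x) := by
      rw [smul_sub, hg, mul_smul, inv_smul_smul]
    rw [h2]
    have h3 := Ideal.smul_mem_pointwise_smul ((F ^ n)⁻¹) _ 𝔐 h1
    rwa [smul_eq_of_mem_localPrimesAbove v h𝔐] at h3
  obtain ⟨i, hi, u, hu, hgu⟩ := (hWmem g).mp (hKSW hgKS)
  refine ⟨n, i, u, hi, hu, ?_⟩
  rw [mul_assoc, ← hgu, hg, mul_inv_cancel_left]

/-- **Corollary: an open subgroup containing `F` and `I_𝔐` is everything.** [folklore] -/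
theorem eq_top_of_isOpen_of_frobenius_mem_of_inertia_le {𝔐 : Ideal (localAbsIntegers v)}
    (h𝔐 : 𝔐 ∈ v.localPrimesAbove) {F : absoluteGaloisGroup (v.adicCompletion K)}
    (hF : IsArithFrobAt (v.adicCompletionIntegers K) F 𝔐)
    {U : Subgroup (absoluteGaloisGroup (v.adicCompletion K))}
    (hU : IsOpen (U : Set (absoluteGaloisGroup (v.adicCompletion K)))) (hFU : F ∈ U)
    (hIU : 𝔐.inertia (absoluteGaloisGroup (v.adicCompletion K)) ≤ U) : U = ⊤ := by
  rw [eq_top_iff]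
  intro σ _
  obtain ⟨n, τ, u, hτ, hu, rfl⟩ := exists_eq_frobenius_pow_mul_inertia_mul v h𝔐 hF hU σ
  exact U.mul_mem (U.mul_mem (U.pow_mem hFU n) (hIU hτ)) hu

end IsDedekindDomain.HeightOneSpectrum

end
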